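import Literature.AnabelianGeometry.SemiGraphs.ThetaRayPowEscape
import Literature.AnabelianGeometry.SemiGraphs.TemperedPiBranchStabilizerRecentred
import HarnessLib

/-!
# Order bookkeeping for the local frames of the powers of the escaping element of `π₁^temp(𝒢_θ)`
# (typed-form audit of [SemiAnbd] Thm 3.7 (iv) clause 2 at `𝒢_θ`, row «B9·ANCHOR-FREE-PAIR», brick K-B4a)

Mochizuki, *Semi-graphs of anabelioids*, Publ. RIMS **42** (2006), §3, Theorem 3.7 (iii)/(iv) pp. 40–41 and
Remark 2.2.1 p. 24 [cite: MochizukiSemiAnbd2006, Thm 3.7(iv) p.41].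

PROOF-ONLY file (abc-iut cell, layer L3, seat abc-iut-L3-d4 gen 5; row «B9·ANCHOR-FREE-PAIR@𝒢_θ» (L3-lead
β50/γ10); frontier / erratum-grade label — typed-form audit of the cell's ∀-countable typing of Thm 3.7 (iv) at
abc-iut-L3-d1's countermodel `𝒢_θ(p,n)`, OUTSIDE the [IUTchIII] Cor. 3.12 cone; 0 definitions, no named fact).
Desk memo `HOME/staging/L3/L3-d4/g5/B9-ANCHOR-FREE-PAIR.md`; this is the «valuation bookkeeping» that feeds the
compact parameter set `Λ` of the detection engine (p468560) and of the frame shift (p471798).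

A FRAME of `x = c^{p^m}` at a point sequence `P` over `w` is `(f, b, λ)` with `ρ_N(x) = σ_N^{f·b_*(λ)·f⁻¹}`
(abc-iut-L3-t11's local branch-stabiliser dictionary).  The engine needs `λ` in a compact subset of `ℤ_p`
missing `0`; this file shows `‖λ‖ ≥ ‖p^m‖` at the levels where `ρ_N(x) ≠ 1`, by ORDER bookkeeping in the
finite `p`-group image of `Π_w`:

* `exists_orderOf_eq_prime_pow_of_tendsto` — in a discrete group, the image of an element `h` of a
  topological group with `h^{p^k} → 1` under a continuous homomorphism has order a power of `p`;
* `mem_zpowers_map_of_dense` — a continuous homomorphism from a topologically cyclic group into a discrete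
  group takes values in the cyclic group generated by the image of the generator (abc-iut-L3-t11's private
  lemma, re-proved);
* `PadicInt.norm_pow_le_norm_of_frame` — the pure arithmetic: if `φ : ℤ_p → Q` takes values in `⟨φ 1⟩`,
  `orderOf (φ 1) = p^e = orderOf ζ`, `ζ^{p^m} ≠ 1` and `φ λ = ζ^{p^m}`, then `‖p^m‖ ≤ ‖λ‖`;
* at `𝒢_θ(p,n)`: `thetaRayFreeProP_exists_orderOf_gal_eq_pow` (orders of the `σ_N^h` are powers of `p`),
  `thetaRayFreeProP_gal_conj_brHom_mem_zpowers`, `thetaRay_orderOf_gal_brHom_eq_of_far` (at far vertices the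
  branch generators `σ_N^{b_*(e₀)}` have the order of `ρ_N(c)` — abc-iut-L3-d4 gen 4's `hord`, public, generic),
  and ★ `thetaRayFreeProP_frame_norm_ge` — at far vertices every frame `(f, b, λ)` of `c^{p^m}` with
  `ρ_N(c)^{p^m} ≠ 1` has `‖p^m‖ ≤ ‖λ‖`.

Nothing of [SemiAnbd] is asserted; nothing bears on [IUTchIII] Cor. 3.12; typed ≠ proved.
-/

noncomputable section

namespace Literature.AnabelianGeometry.SemiGraphs

open CategoryTheory Filter Topology Multiplicative
open ProfiniteSemiGraph ProfiniteSemiGraph.GaloisLevelData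

/-! ### Generic group theory -/

section Generic

/-- In a discrete group, the image of `h` under a continuous homomorphism has order a power of `p` as soon
as `h^{p^k} → 1`. [cite: RibesZalesskii2010, §2.3] -/
theorem exists_orderOf_eq_prime_pow_of_tendsto {G Q : Type*} [Group G] [TopologicalSpace G] [Group Q]
    [TopologicalSpace Q] [DiscreteTopology Q] (p : ℕ) (hp : p.Prime) (φ : G →* Q) (hφ : Continuous φ)
    (h : G) (hh : Tendsto (fun k : ℕ => h ^ p ^ k) atTop (𝓝 1)) :
    ∃ e : ℕ, orderOf (φ h) = p ^ e := by
  have h1 : Tendsto (fun k : ℕ => φ h ^ p ^ k) atTop (𝓝 1) := by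
    have := (hφ.tendsto 1).comp hh
    simp only [Function.comp_def, map_pow, map_one] at this
    exact this
  rw [nhds_discrete, tendsto_pure] at h1
  obtain ⟨k, hk⟩ := h1.exists
  obtain ⟨e, -, he⟩ := (Nat.dvd_prime_pow hp).mp (orderOf_dvd_of_pow_eq_one hk)
  exact ⟨e, he⟩

/-- A continuous homomorphism from a topologically cyclic group into a discrete group takes its values in
the cyclic group generated by the image of the topological generator. [cite: RibesZalesskii2010, §2.3] -/
theorem mem_zpowers_map_of_dense {E Q : Type*} [Group E] [TopologicalSpace E] [IsTopologicalGroup E]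
    [Group Q] [TopologicalSpace Q] [DiscreteTopology Q] (e₀ : E)
    (hgen : (Subgroup.zpowers e₀).topologicalClosure = ⊤) (τ : E →* Q) (hτ : Continuous τ) (t : E) :
    τ t ∈ Subgroup.zpowers (τ e₀) := by
  have ht : t ∈ (Subgroup.zpowers e₀).topologicalClosure := by rw [hgen]; exact Subgroup.mem_top t
  have h1 : τ t ∈ closure (τ '' (Subgroup.zpowers e₀ : Set E)) :=
    image_closure_subset_closure_image hτ ⟨t, ht, rfl⟩
  have h2 : τ '' (Subgroup.zpowers e₀ : Set E) = (Subgroup.zpowers (τ e₀) : Set Q) := by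
    rw [← Subgroup.coe_map, MonoidHom.map_zpowers]
  rw [h2, (isClosed_discrete (Subgroup.zpowers (τ e₀) : Set Q)).closure_eq] at h1
  exact h1

/-- `orderOf (g h g⁻¹) = orderOf h`. [folklore] -/
private theorem orderOf_conj' {Q : Type*} [Group Q] (g h : Q) : orderOf (g * h * g⁻¹) = orderOf h :=
  (SemiconjBy.orderOf_eq g (show SemiconjBy g h (g * h * g⁻¹) by
    simp only [SemiconjBy, inv_mul_cancel_right])).symm

/-- **The arithmetic of the frame orders**: for a homomorphism `φ : ℤ_p → Q` (multiplicative notation) with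
values in `⟨φ 1⟩`, `orderOf (φ 1) = p^e = orderOf ζ`, `ζ^{p^m} ≠ 1` and `φ λ = ζ^{p^m}`, one has
`‖p^m‖ ≤ ‖λ‖` (`v_p(λ) ≤ m`). [cite: RibesZalesskii2010, §2.3] -/
theorem PadicInt.norm_pow_le_norm_of_frame {Q : Type*} [Group Q] (p : ℕ) [hp : Fact p.Prime]
    (φ : Multiplicative ℤ_[p] →* Q) (hz : ∀ t, φ t ∈ Subgroup.zpowers (φ (ofAdd 1))) {e : ℕ}
    (he : orderOf (φ (ofAdd 1)) = p ^ e) (ζ : Q) (hζ : orderOf ζ = p ^ e) (m : ℕ) (hne : ζ ^ p ^ m ≠ 1)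
    (l : Multiplicative ℤ_[p]) (hl : φ l = ζ ^ p ^ m) :
    ‖(p : ℤ_[p]) ^ m‖ ≤ ‖l.toAdd‖ := by
  have hp1 : 1 < p := hp.out.one_lt
  -- `m < e` since `ζ ^ p^m ≠ 1`
  have hme : m < e := by
    by_contra hle
    push Not at hle
    exact hne (orderOf_dvd_iff_pow_eq_one.mp (hζ ▸ Nat.pow_dvd_pow p hle))
  -- `orderOf (ζ ^ p^m) = p^(e-m)`
  have hord : orderOf (ζ ^ p ^ m) = p ^ (e - m) := by
    rw [orderOf_pow' ζ (pow_ne_zero m hp.out.ne_zero), hζ,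
      Nat.gcd_eq_right (Nat.pow_dvd_pow p hme.le), Nat.pow_div hme.le hp.out.pos]
  by_contra hlt
  push Not at hlt
  -- then `‖λ‖ ≤ p^{-(m+1)}`, so `λ = μ · p^(m+1)`
  have hle : ‖l.toAdd‖ ≤ (p : ℝ) ^ (-((m + 1 : ℕ) : ℤ)) := by
    rw [PadicInt.norm_le_pow_iff_norm_lt_pow_add_one]
    have : (-((m + 1 : ℕ) : ℤ)) + 1 = -(m : ℤ) := by push_cast; ring
    rw [this]
    have h2 : ‖(p : ℤ_[p]) ^ m‖ = (p : ℝ) ^ (-(m : ℤ)) := by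
      rw [norm_pow, PadicInt.norm_p, zpow_neg, zpow_natCast, inv_pow]
    rw [← h2]
    exact hlt
  rw [PadicInt.norm_le_pow_iff_mem_span_pow] at hle
  obtain ⟨μ, hμ⟩ := Ideal.mem_span_singleton'.mp hle
  -- `φ λ = η ^ p^(m+1)` with `η = φ μ ∈ ⟨φ 1⟩`, so its order is at most `p^(e-m-1)`
  have hlμ : l = (ofAdd μ) ^ p ^ (m + 1) := by
    rw [← ofAdd_nsmul, nsmul_eq_mul, Nat.cast_pow, mul_comm, hμ, ofAdd_toAdd]
  have hη : orderOf (φ (ofAdd μ)) ∣ p ^ e := he ▸ orderOf_dvd_of_mem_zpowers (hz (ofAdd μ))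
  have hpow : (φ l) ^ p ^ (e - m - 1) = 1 := by
    rw [hlμ, map_pow, ← pow_mul, ← pow_add]
    have : m + 1 + (e - m - 1) = e := by omega
    rw [this]
    exact orderOf_dvd_iff_pow_eq_one.mp hη
  have hdvd : orderOf (φ l) ∣ p ^ (e - m - 1) := orderOf_dvd_of_pow_eq_one hpow
  have hle' : orderOf (φ l) ≤ p ^ (e - m - 1) := Nat.le_of_dvd (pow_pos hp.out.pos _) hdvd
  rw [hl, hord] at hle'
  exact absurd hle' (not_le.mpr (Nat.pow_lt_pow_right hp1 (by omega)))

end Generic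

/-! ### Orders of the level components at `𝒢_θ(p,n)` -/

namespace ProfiniteSemiGraph

open Literature.AnabelianGeometry.SemiGraphs.FreeProPRankTwo

variable (p : ℕ) [hp : Fact p.Prime] (n : ℕ → ℕ)

/-- **The orders of the level components `σ_N^h` (`h ∈ F̂₂⁽ᵖ⁾`) at `𝒢_θ(p,n)` are powers of `p`** (the vertex
groups are pro-`p`: `h^{p^k} → 1`). [cite: MochizukiSemiAnbd2006, Thm 3.7(i) p.40] -/
theorem thetaRayFreeProP_exists_orderOf_gal_eq_pow (h36 : (thetaRayFreeProP p n).Prop36Hypotheses)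
    {w : ℕ} (P : ((thetaRayFreeProP p n).galoisLevelData h36).PointSeq h36.isCountable w) (N : ℕ)
    (h : Grp p) : ∃ e : ℕ, orderOf (P.gal N h) = p ^ e := by
  have hφ : Continuous ((((thetaRayFreeProP p n).galoisLevelData h36).proj h36.isCountable N).comp
      P.decompHom) :=
    (((thetaRayFreeProP p n).galoisLevelData h36).continuous_proj h36.isCountable N).comp P.continuous_decompHom
  obtain ⟨e, he⟩ := exists_orderOf_eq_prime_pow_of_tendsto p hp.out _ hφ h (tendsto_pow_prime_pow p h)
  exact ⟨e, he⟩

/-- **A conjugated branch frame takes its values in the cyclic group of its generator**: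
`σ_N^{f·b_*(λ)·f⁻¹} ∈ ⟨σ_N^{f·b_*(1)·f⁻¹}⟩` at `𝒢_θ(p,n)` (`ℤ_p` topologically cyclic).
[cite: MochizukiSemiAnbd2006, Rmk 2.2.1 p.24] -/
theorem thetaRayFreeProP_gal_conj_brHom_mem_zpowers (h36 : (thetaRayFreeProP p n).Prop36Hypotheses)
    {w : ℕ} (P : ((thetaRayFreeProP p n).galoisLevelData h36).PointSeq h36.isCountable w) (N : ℕ)
    (b : ℕ × Bool) (hb : SemiGraph.ray.abuts b = some w) (f y₁ y : Grp p) (l : Multiplicative ℤ_[p])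
    (hy₁ : y₁ = (thetaRayFreeProP p n).brHom b w hb (ofAdd (1 : ℤ_[p]))) (hy : y = (thetaRayFreeProP p n).brHom b w hb l) :
    P.gal N (f * y * f⁻¹) ∈ Subgroup.zpowers (P.gal N (f * y₁ * f⁻¹)) := by
  subst hy₁ hy
  let τ : Multiplicative ℤ_[p] →* ((thetaRayFreeProP p n).galoisLevelData h36).Gal h36.isCountable N :=
    ((((thetaRayFreeProP p n).galoisLevelData h36).proj h36.isCountable N).comp P.decompHom).comp
      ((MulAut.conj f).toMonoidHom.comp ((thetaRayFreeProP p n).brHom b w hb).toMonoidHom)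
  have hconjc : Continuous (fun x : Grp p => f * x * f⁻¹) :=
    (continuous_const.mul continuous_id).mul continuous_const
  have hτ : Continuous τ :=
    ((((thetaRayFreeProP p n).galoisLevelData h36).continuous_proj h36.isCountable N).comp
      P.continuous_decompHom).comp (hconjc.comp ((thetaRayFreeProP p n).brHom b w hb).continuous)
  exact mem_zpowers_map_of_dense (ofAdd (1 : ℤ_[p])) PadicInt.topologicalClosure_zpowers_ofAdd_one τ hτ l

end ProfiniteSemiGraph

/-! ### The branch generators at far vertices have the order of `ρ_N(c)` (abc-iut-L3-d4 gen 4's `hord`, public) -/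

section GenericRay

variable {G E : Type} [Group G] [TopologicalSpace G] [IsTopologicalGroup G] [CompactSpace G]
  [TotallyDisconnectedSpace G] [Group E] [TopologicalSpace E] [IsTopologicalGroup E] [CompactSpace E]
  [TotallyDisconnectedSpace E] {up : E →ₜ* G} {low : ℕ → (E →ₜ* G)}

/-- **At far vertices every branch generator `σ_N^{b_*(e₀)}` has the order of `ρ_N(c)`** (generic ray of
groups; `c` any element with `ρ_j(c) = ρ_j(z_k)` for `k ≥ N_j`, `z_k` the apartment generators of `e₀`):
for every level `n` and every vertex `k ≥ N_n + 1`, every branch `b` at `k` and every point sequence `P`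
over `k`. [cite: MochizukiSemiAnbd2006, Thm 3.7(iv) p.41] -/
theorem thetaRay_orderOf_gal_brHom_eq_of_far (h36 : (thetaRay G E up low).Prop36Hypotheses)
    (P₀ : ((thetaRay G E up low).galoisLevelData h36).PointSeq h36.isCountable (0 : ℕ)) (e₀ : E)
    (c : ((thetaRay G E up low).galoisLevelData h36).temperedPi h36.isCountable) (N : ℕ → ℕ)
    (hN : ∀ j k, N j ≤ k →
      ((thetaRay G E up low).galoisLevelData h36).proj h36.isCountable j c =
        ((thetaRay G E up low).galoisLevelData h36).proj h36.isCountable j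
          ((rayPointSeq (D := (thetaRay G E up low).galoisLevelData h36) thetaRay_ham thetaRay_hap
            thetaRay_hmp P₀ (k + 1)).decompHom ((thetaRay G E up low).brHom (k, true) (k + 1) (thetaRay_hap k) e₀)))
    (n : ℕ) (b : ℕ × Bool) (k : ℕ) (hb : (thetaRay G E up low).graph.abuts b = some k) (hk : N n + 1 ≤ k)
    (P : ((thetaRay G E up low).galoisLevelData h36).PointSeq h36.isCountable k) :
    orderOf (P.gal n ((thetaRay G E up low).brHom b k hb e₀)) =
      orderOf (((thetaRay G E up low).galoisLevelData h36).proj h36.isCountable n c) := by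
  classical
  let T : ProfiniteSemiGraph.{0} := thetaRay G E up low
  let Dg : GaloisLevelData T := T.galoisLevelData h36
  have hc := h36.isCountable
  have hcover := Dg.cover_sameComponent hc
  have htrans := Dg.cover_htrans hc
  -- apartment-type branches `(m, true)` at `m + 1`, `N n ≤ m`
  have hord_apt : ∀ (m : ℕ), N n ≤ m →
      ∀ y : ((Dg.cover hc n).SV (m + 1)).obj.V,
        orderOf ((Dg.cover hc n).ptHom (hcover n) (htrans n) y (T.brHom (m, true) (m + 1) (thetaRay_hap m) e₀)) =
          orderOf (Dg.proj hc n c) := by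
    intro m hm y
    set Pm := rayPointSeq (D := Dg) thetaRay_ham thetaRay_hap thetaRay_hmp P₀ (m + 1) with hPm
    have h1 : (Dg.cover hc n).ptHom (hcover n) (htrans n) (Pm.pt n) (T.brHom (m, true) (m + 1) (thetaRay_hap m) e₀) =
        Dg.proj hc n (Pm.decompHom (T.brHom (m, true) (m + 1) (thetaRay_hap m) e₀)) :=
      Pm.eq_gal n _ _ ((Dg.cover hc n).ptHom_apply (hcover n) (htrans n) (Pm.pt n) _)
    have h2 : Dg.proj hc n c = Dg.proj hc n (Pm.decompHom (T.brHom (m, true) (m + 1) (thetaRay_hap m) e₀)) :=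
      hN n m hm
    rw [(Dg.cover hc n).orderOf_ptHom_eq_of_htrans (hcover n) (htrans n) y (Pm.pt n), h1]
    exact congrArg orderOf h2.symm
  -- any branch at a far vertex, in cover coordinates
  have hord : ∀ y : ((Dg.cover hc n).SV k).obj.V,
      orderOf ((Dg.cover hc n).ptHom (hcover n) (htrans n) y (T.brHom b k hb e₀)) =
        orderOf (Dg.proj hc n c) := by
    rcases b with ⟨j, _ | _⟩
    · -- `b = (j, false)`: `k = j`; read through the OTHER branch `(j, true)` at `j + 1`
      intro y
      have hjk : j = k := Option.some.inj ((thetaRay_ham (G := G) (E := E) (up := up) (low := low) j).symm.trans hb)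
      subst hjk
      set yE : ((Dg.cover hc n).SE j).obj.V := ((Dg.cover hc n).glue (j, false) j hb).inv.hom.hom y with hyE
      have hy : ((Dg.cover hc n).glue (j, false) j hb).hom.hom.hom yE = y := (Dg.cover hc n).glue_hom_inv (j, false) j hb y
      set y' : ((Dg.cover hc n).SV (j + 1)).obj.V := ((Dg.cover hc n).glue (j, true) (j + 1) (thetaRay_hap j)).hom.hom.hom yE
        with hy'
      have key : ∀ d : ℕ,
          (Dg.cover hc n).ptHom (hcover n) (htrans n) y (T.brHom (j, false) j hb e₀) ^ d = 1 ↔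
            (Dg.cover hc n).ptHom (hcover n) (htrans n) y' (T.brHom (j, true) (j + 1) (thetaRay_hap j) e₀) ^ d = 1 := by
        intro d
        have h1 := (Dg.cover hc n).ptHom_brHom_pow_eq_one_iff_of_glue (hcover n) (htrans n) hb yE e₀ d
        rw [hy] at h1
        have h2 := (Dg.cover hc n).ptHom_brHom_pow_eq_one_iff_of_glue (hcover n) (htrans n) (thetaRay_hap j) yE e₀ d
        exact h1.trans h2.symm
      rw [orderOf_eq_orderOf_iff.mpr key]
      exact hord_apt j (by omega) y'
    · -- `b = (j, true)`: `k = j + 1`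
      intro y
      have hjk : j + 1 = k := Option.some.inj ((thetaRay_hap (G := G) (E := E) (up := up) (low := low) j).symm.trans hb)
      subst hjk
      exact hord_apt j (by omega) y
  -- the point sequence `P`: `σ_n^h = ψ_{P.pt n}(h)`
  have hP : P.gal n (T.brHom b k hb e₀) = (Dg.cover hc n).ptHom (hcover n) (htrans n) (P.pt n) (T.brHom b k hb e₀) :=
    (P.eq_gal n _ _ ((Dg.cover hc n).ptHom_apply (hcover n) (htrans n) (P.pt n) _)).symm
  rw [hP]
  exact hord (P.pt n)

end GenericRay

/-! ### The frame norms at `𝒢_θ(p,n)` -/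

namespace ProfiniteSemiGraph

open Literature.AnabelianGeometry.SemiGraphs.FreeProPRankTwo

variable (p : ℕ) [hp : Fact p.Prime] (n : ℕ → ℕ)

/-- **Every frame of `c^{p^m}` at a far vertex has `‖p^m‖ ≤ ‖λ‖`** (at the levels where `ρ_N(c)^{p^m} ≠ 1`):
at `𝒢_θ(p,n)`, for `c` with `ρ_j(c) = ρ_j(z_k)` (`k ≥ N_j`), every level `N`, every far vertex `k ≥ N_N + 1`,
branch `b` at `k`, point sequence `P` over `k`, `f ∈ F̂₂⁽ᵖ⁾` and `λ ∈ ℤ_p` with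
`σ_N^{f·b_*(λ)·f⁻¹} = ρ_N(c)^{p^m} ≠ 1`, the parameter `λ` lies in the compact shell `‖λ‖ ≥ ‖p^m‖` of the
detection engine. [cite: MochizukiSemiAnbd2006, Thm 3.7(iv) p.41] -/
theorem thetaRayFreeProP_frame_norm_ge (h36 : (thetaRayFreeProP p n).Prop36Hypotheses)
    (P₀ : ((thetaRayFreeProP p n).galoisLevelData h36).PointSeq h36.isCountable (0 : ℕ))
    (c : ((thetaRayFreeProP p n).galoisLevelData h36).temperedPi h36.isCountable) (Nc : ℕ → ℕ)
    (hN : ∀ j k, Nc j ≤ k →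
      ((thetaRayFreeProP p n).galoisLevelData h36).proj h36.isCountable j c =
        ((thetaRayFreeProP p n).galoisLevelData h36).proj h36.isCountable j
          ((rayPointSeq (D := (thetaRayFreeProP p n).galoisLevelData h36) thetaRay_ham thetaRay_hap
            thetaRay_hmp P₀ (k + 1)).decompHom
            ((thetaRayFreeProP p n).brHom (k, true) (k + 1) (thetaRay_hap k) (ofAdd (1 : ℤ_[p])))))
    (m N : ℕ) (hne : (((thetaRayFreeProP p n).galoisLevelData h36).proj h36.isCountable N c) ^ p ^ m ≠ 1)
    (k : ℕ) (hk : Nc N + 1 ≤ k) (b : ℕ × Bool) (hb : SemiGraph.ray.abuts b = some k)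
    (P : ((thetaRayFreeProP p n).galoisLevelData h36).PointSeq h36.isCountable k) (f y : Grp p)
    (l : Multiplicative ℤ_[p]) (hy : y = (thetaRayFreeProP p n).brHom b k hb l)
    (hframe : P.gal N (f * y * f⁻¹) =
      (((thetaRayFreeProP p n).galoisLevelData h36).proj h36.isCountable N c) ^ p ^ m) :
    ‖(p : ℤ_[p]) ^ m‖ ≤ ‖l.toAdd‖ := by
  subst hy
  -- the frame homomorphism `φ : t ↦ σ_N^{f b_*(t) f⁻¹}`
  set y₁ : Grp p := (thetaRayFreeProP p n).brHom b k hb (ofAdd (1 : ℤ_[p])) with hy₁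
  let φ : Multiplicative ℤ_[p] →* ((thetaRayFreeProP p n).galoisLevelData h36).Gal h36.isCountable N :=
    ((((thetaRayFreeProP p n).galoisLevelData h36).proj h36.isCountable N).comp P.decompHom).comp
      ((MulAut.conj f).toMonoidHom.comp ((thetaRayFreeProP p n).brHom b k hb).toMonoidHom)
  have hconjc : Continuous (fun x : Grp p => f * x * f⁻¹) :=
    (continuous_const.mul continuous_id).mul continuous_const
  have hφc : Continuous φ :=
    ((((thetaRayFreeProP p n).galoisLevelData h36).continuous_proj h36.isCountable N).comp
      P.continuous_decompHom).comp (hconjc.comp ((thetaRayFreeProP p n).brHom b k hb).continuous)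
  have hz : ∀ t, φ t ∈ Subgroup.zpowers (φ (ofAdd 1)) := fun t =>
    mem_zpowers_map_of_dense (ofAdd (1 : ℤ_[p])) PadicInt.topologicalClosure_zpowers_ofAdd_one φ hφc t
  -- orders: `φ 1` has order `p^e`, the order of `ρ_N(c)` (far vertex), which is also a power of `p`
  have hconj : orderOf (φ (ofAdd 1)) = orderOf (P.gal N y₁) := by
    let ψ := (((thetaRayFreeProP p n).galoisLevelData h36).proj h36.isCountable N).comp P.decompHom
    have hψ : ∀ x : Grp p, P.gal N x = ψ x := fun x => rfl
    have e1 : φ (ofAdd 1) = ψ f * ψ y₁ * (ψ f)⁻¹ := by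
      have h1 : ψ (f * y₁ * f⁻¹) = ψ (f * y₁) * ψ f⁻¹ := map_mul ψ _ _
      have h2 : ψ (f * y₁) = ψ f * ψ y₁ := map_mul ψ _ _
      have h3 : ψ f⁻¹ = (ψ f)⁻¹ := map_inv ψ _
      have h0 : φ (ofAdd 1) = ψ (f * y₁ * f⁻¹) := rfl
      rw [h0, h1, h2, h3]
    rw [e1, hψ]
    exact orderOf_conj' _ _
  obtain ⟨e, he₁⟩ := thetaRayFreeProP_exists_orderOf_gal_eq_pow p n h36 P N y₁
  have hfar : orderOf (P.gal N y₁) =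
      orderOf (((thetaRayFreeProP p n).galoisLevelData h36).proj h36.isCountable N c) := by
    rw [hy₁]
    exact thetaRay_orderOf_gal_brHom_eq_of_far (G := Grp p) (E := Multiplicative ℤ_[p]) (up := α p)
      (low := fun k => θα p (n k)) h36 P₀ (ofAdd (1 : ℤ_[p])) c Nc hN N b k hb hk P
  refine PadicInt.norm_pow_le_norm_of_frame p φ hz (hconj.trans he₁) _ (hfar ▸ he₁) m hne l ?_
  exact hframe

end ProfiniteSemiGraph

end Literature.AnabelianGeometry.SemiGraphs

end
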